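import Summits.QuantumFields.YangMills.Theorems.BalabanUVNodesN08MassesACLeastClosedFamily
import Summits.QuantumFields.YangMills.Theorems.BalabanUVNodesN08HaarCompatibilityGuardTransport
import Summits.QuantumFields.YangMills.Theorems.BalabanUVNodesN08Thm2AtRecordBridgeInhabited

/-!
# BalabanUVNodes ∕ N08 — THE LEAST CLOSED FAMILY AT PRINT'S AVERAGING: the junction of file 17's weak-closure reduction with n08-w3 g4's guard
# family (`…HaarCompatibilityGuardTransport`, p609378) — an UNCONDITIONAL measure bound on print's iterated Radon–Nikodym history masses

Track A, DAG node N08 = T. Bałaban, CMP **102** (1985) 255–275 [Balaban1985UV3]: (41) p. 266, (48) p. 268, (2) p. 256; the averaging (2) = [Balaban1985Averaging]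
(15) p. 19; the typed (0.4) averaging and its small-field guard = [Balaban1987RG1] (0.4) p. 253.  Cell `pub-ymgap`, width seat `pub-ymgap-dag-n08-w1` (g4),
W-SEAT-START-LIST §n08 item 1 successor piece (o11b) = file 17b (split off file 17 `…N08MassesACLeastClosedFamily`, p611839, because it imports p609378);
`--supports` K1⁷ `StabilityBAtRecordR13SepCoPH` (helper).

WHAT THIS FILE PROVES (kernel; theorems only, 0 def; [folklore] measure theory; nothing of the paper asserted).  At the [B10] slot's averaging `avOfPrint N S` on
`SU(N)` (every `N ≥ 1`), with `G_j = {U | ∃ c, Small expMeanLogSU U c}` the small-field guard of the typed (0.4) averaging: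
* `weakClosed_avOfPrint_of_guardRec` — a GUARD-RECURSIVE family (`ν_{j+1} ≥ (dU_j↾G_j)∘Ū_j⁻¹ + ν_j∘Ū_j⁻¹`, `j + 1 ≤ K`) is weakly closed up to `K`
  (n08-w3's `map_add_le_closure_avOfPrint`).
* ★★★ `withDensity_massRecAC_avOfPrint_le_of_guardRec` — **UNCONDITIONAL: print's iterated RN history masses `m = MassesAC.massRecAC M₁ Rcol ε_L ε_S (avOfPrint N S)`
  obey `m_k(h,·)·dU_k ≤ dU_k + ν_k` for every `k ≤ K`, every history, ANY thresholds, ANY guard-recursive `ν`** (file 17 §2 + the guard split + `AvgAC` of (15)).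
* ★★ `massRecAC_avOfPrint_le_exp_ae_of_guardRec` — hence the a.e. EXTENSIVE MASS BOUND at print's averaging ⟸ a density bound `ν_k ≤ (e^{c_k} − 1)·dU_k` on a
  guard-recursive family (no Haar copies).
* `exists_guardRec_avOfPrint` — the guard recursion is inhabited with equality (n08-w3's family), total mass `Σ_{j<k} dU_j(G_j)`.
* ★ `oneStepExcess_avOfPrint_le_guard` — `dU_j∘Ū_j⁻¹ − dU_{j+1} ≤ (dU_j↾G_j)∘Ū_j⁻¹`: the one-step excess over Haar is at most the image of the guarded part
  (`axial_*(dU_j) = dU_{j+1}` exactly); `excessRec_le_guardRec_avOfPrint` — file 17's least family `ν♯ ≤ ν` for every guard-recursive `ν`;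
  `withDensity_massRecAC_avOfPrint_le_excessRec` — the bound in its sharpest closed-family form, every `k`.

LOCATED READING (count-neutral): the hierarchy of analytic targets for (a) at print's averaging is `ν♯` (iterated one-step EXCESS, file 17 §4) ≤ `μ` (transported
one-step excesses, file 17 §4b) ≤ `ν^G` (transported guarded images, n08-w3); a `dV_k`-a.e. density bound `≤ e^{c|T₁^{(k)}|} − 1` on ANY of them gives file 15's `hmass`
a.e. (and file 18's B25 a.e.).  None is claimed.

HONEST FRAMING: count-neutral helper; no density bound is claimed — (a) stays OPEN; E6′ NOT decided; `hmass` NOT supplied; N08 NOT discharged; one finite 𝕋⁴ programme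
at fixed ε, Bałaban AS PRINTED — R4 closes the conditional finite-𝕋⁴ rung `BalabanLadder.UV` only; the Yang–Mills mass gap (Clay) is NOT proved by any of this;
nothing continuum ∕ ℝ⁴ ∕ OS.  No `sorry`, standard axioms.
-/

noncomputable section

open MeasureTheory
open scoped ENNReal

namespace Summit.QuantumFields.YangMills.BalabanUVNodes.N08MassesACLeastClosedFamilyPrint

open Literature.MathematicalPhysics.QuantumFieldTheory.Balaban1983to89
open Summit.QuantumFields.Balaban3D.Carriers
open Summit.QuantumFields.Balaban3D.Proofs.MassesAC
open Summit.QuantumFields.YangMills.BalabanUVNodes.N08MassesACLeastClosedFamily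

/-! ## At the [B10] slot's averaging `avOfPrint N S` on `SU(N)` -/
section Print

open Literature.MathematicalPhysics.QuantumFieldTheory.Balaban1985CMP102.Setting (Scales)
open Literature.MathematicalPhysics.QuantumFieldTheory.Balaban1983to89.B10RunsOfRecord (avOfPrint)
open Literature.MathematicalPhysics.QuantumFieldTheory.Balaban1983to89.ExpMeanLog (expMeanLogSU)
open Literature.MathematicalPhysics.QuantumFieldTheory.Balaban1983to89.BlockAveraging (Small)
open Literature.MathematicalPhysics.QuantumFieldTheory.Balaban1983to89.Node00 (SU)
open Literature.MathematicalPhysics.QuantumFieldTheory.Balaban1983to89.AveragingRT (axialAvg map_axialAvg)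
open Summit.QuantumFields.YangMills.BalabanUVNodes.N08HaarCompatibilityGuardTransport (map_avOfPrint_le map_add_le_closure_avOfPrint closure_mass_add)
open Summit.QuantumFields.YangMills.BalabanUVNodes.N08Thm2AtRecordBridgeInhabited (avgAC_avOfPrint)

variable (N : ℕ) [NeZero N] {L : ℕ} (S : Scales L) (M₁ : ℕ) (Rcol : ℕ → ℕ) (εL εS : ℕ → ℝ)

/-- **A GUARD-RECURSIVE FAMILY AT PRINT'S AVERAGING IS WEAKLY CLOSED up to level `K`**: if `ν_{j+1} ≥ (dU_j↾G_j)∘Ū_j⁻¹ + ν_j∘Ū_j⁻¹` for `j + 1 ≤ K`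
(`G_j = {U | ∃ c, Small expMeanLogSU U c}` the small-field guard of the typed (0.4) averaging, `Ū_j = avOfPrint N S j`), then
`(dU_j + ν_j)∘Ū_j⁻¹ ≤ dU_{j+1} + ν_{j+1}` for `j < K` — n08-w3 g4's `map_add_le_closure_avOfPrint` (p609378) in the standing range `j + 1 ≤ m + K`.
[cite: Balaban1987RG1, (0.4) p.253; Balaban1985UV3, (2) p.256 (bookkeeping)] -/
theorem weakClosed_avOfPrint_of_guardRec (ν : ∀ k, Measure (GaugeField S.P k (SU N)))
    (hrec : ∀ j, j + 1 ≤ S.K →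
      ((fieldMeasure S.P j (SU N)).restrict
          {U : GaugeField S.P j (SU N) | ∃ c : PBond S.P (j + 1), Small (expMeanLogSU : LoopAverage (SU N)) U c}).map (avOfPrint N S j).avg +
        (ν j).map (avOfPrint N S j).avg ≤ ν (j + 1)) :
    ∀ j, j < S.K → (fieldMeasure S.P j (SU N) + ν j).map (avOfPrint N S j).avg ≤ fieldMeasure S.P (j + 1) (SU N) + ν (j + 1) := by
  intro j hj
  have hjr : j + 1 ≤ S.P.m + S.P.K := by show j + 1 ≤ S.m + S.K; omega
  exact (map_add_le_closure_avOfPrint N S hjr (ν j)).trans (add_le_add le_rfl (hrec j (by omega)))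

/-- ★★★ **UNCONDITIONAL MEASURE BOUND ON PRINT'S ITERATED RADON–NIKODYM HISTORY MASSES**: for print's averaging (2) = [Balaban1985Averaging] (15) on `SU(N)`
(every `N ≥ 1`), ANY thresholds, and ANY guard-recursive family `ν` (`ν_{j+1} ≥ (dU_j↾G_j)∘Ū_j⁻¹ + ν_j∘Ū_j⁻¹`, `j + 1 ≤ K`):
**`m_k(h,·)·dU_k ≤ dU_k + ν_k` for every `k ≤ K` and every history `h`** (`m = MassesAC.massRecAC M₁ Rcol ε_L ε_S (avOfPrint N S)`).  No hypothesis on Bałaban's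
objects is left here: file 17 §2 + n08-w3's guard split + `AvgAC` of (15) (`avgAC_avOfPrint`).  What it does NOT give is a DENSITY bound on `ν_k` — that is the
analysis (a). [cite: Balaban1985UV3, (41) p.266 + (48) p.268 + (2) p.256; Balaban1985Averaging, (15) p.19; Balaban1987RG1, (0.4) p.253] -/
theorem withDensity_massRecAC_avOfPrint_le_of_guardRec (ν : ∀ k, Measure (GaugeField S.P k (SU N)))
    (hrec : ∀ j, j + 1 ≤ S.K →
      ((fieldMeasure S.P j (SU N)).restrict
          {U : GaugeField S.P j (SU N) | ∃ c : PBond S.P (j + 1), Small (expMeanLogSU : LoopAverage (SU N)) U c}).map (avOfPrint N S j).avg +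
        (ν j).map (avOfPrint N S j).avg ≤ ν (j + 1))
    (k : ℕ) (hk : k ≤ S.K) (h : Hist S.P k) :
    (fieldMeasure S.P k (SU N)).withDensity (fun V => ENNReal.ofReal (massRecAC M₁ Rcol εL εS (avOfPrint N S) k h V)) ≤
      fieldMeasure S.P k (SU N) + ν k :=
  withDensity_massRecAC_le_of_weakClosed M₁ Rcol εL εS (avOfPrint N S) (avgAC_avOfPrint N L S) S.K ν
    (weakClosed_avOfPrint_of_guardRec N S ν hrec) k hk h

/-- ★★ **… hence the a.e. EXTENSIVE MASS BOUND AT PRINT'S AVERAGING ⟸ A DENSITY BOUND ON A GUARD-RECURSIVE FAMILY**: if moreover `ν_k ≤ (e^{c_k} − 1)·dU_k` for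
`k ≤ K` (`c_k ≥ 0`), then `m_k(h,V) ≤ e^{c_k}` for `dU_k`-a.e. `V` — the a.e. form of file 15's `hmass` at the slot of record, now resting ONLY on a density bound for
the transported GUARDED parts (no Haar copies). [cite: Balaban1985UV3, (41) p.266 + (5) p.256; Balaban1987RG1, (0.4) p.253] -/
theorem massRecAC_avOfPrint_le_exp_ae_of_guardRec (ν : ∀ k, Measure (GaugeField S.P k (SU N)))
    (hrec : ∀ j, j + 1 ≤ S.K →
      ((fieldMeasure S.P j (SU N)).restrict
          {U : GaugeField S.P j (SU N) | ∃ c : PBond S.P (j + 1), Small (expMeanLogSU : LoopAverage (SU N)) U c}).map (avOfPrint N S j).avg +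
        (ν j).map (avOfPrint N S j).avg ≤ ν (j + 1))
    (c : ℕ → ℝ) (hc : ∀ k, 0 ≤ c k) (hνc : ∀ k, k ≤ S.K → ν k ≤ ENNReal.ofReal (Real.exp (c k) - 1) • fieldMeasure S.P k (SU N))
    (k : ℕ) (hk : k ≤ S.K) (h : Hist S.P k) :
    ∀ᵐ V ∂(fieldMeasure S.P k (SU N)), massRecAC M₁ Rcol εL εS (avOfPrint N S) k h V ≤ Real.exp (c k) :=
  massRecAC_le_exp_ae_of_weakClosed M₁ Rcol εL εS (avOfPrint N S) (avgAC_avOfPrint N L S) S.K ν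
    (weakClosed_avOfPrint_of_guardRec N S ν hrec) c hc hνc k hk h

/-- **THE GUARD RECURSION IS INHABITED WITH EQUALITY** — n08-w3's family `ν^G_0 = 0`, `ν^G_{j+1} = (dU_j↾G_j)∘Ū_j⁻¹ + ν^G_j∘Ū_j⁻¹`, by recursion on the level;
its total mass is `ν^G_k(univ) = Σ_{j<k} dU_j(G_j)` (`closure_mass_add`). [cite: Balaban1987RG1, (0.4) p.253 (bookkeeping)] -/
theorem exists_guardRec_avOfPrint :
    ∃ νG : ∀ k, Measure (GaugeField S.P k (SU N)), νG 0 = 0 ∧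
      (∀ j, νG (j + 1) =
        ((fieldMeasure S.P j (SU N)).restrict
            {U : GaugeField S.P j (SU N) | ∃ c : PBond S.P (j + 1), Small (expMeanLogSU : LoopAverage (SU N)) U c}).map (avOfPrint N S j).avg +
          (νG j).map (avOfPrint N S j).avg) ∧
      ∀ k, νG k Set.univ = ∑ j ∈ Finset.range k,
        fieldMeasure S.P j (SU N) {U : GaugeField S.P j (SU N) | ∃ c : PBond S.P (j + 1), Small (expMeanLogSU : LoopAverage (SU N)) U c} := by
  let νG : ∀ k, Measure (GaugeField S.P k (SU N)) := fun k =>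
    Nat.rec (motive := fun k => Measure (GaugeField S.P k (SU N))) 0
      (fun j νj => ((fieldMeasure S.P j (SU N)).restrict
          {U : GaugeField S.P j (SU N) | ∃ c : PBond S.P (j + 1), Small (expMeanLogSU : LoopAverage (SU N)) U c}).map (avOfPrint N S j).avg +
        νj.map (avOfPrint N S j).avg) k
  have h0 : νG 0 = 0 := rfl
  have hsucc : ∀ j, νG (j + 1) = ((fieldMeasure S.P j (SU N)).restrict
      {U : GaugeField S.P j (SU N) | ∃ c : PBond S.P (j + 1), Small (expMeanLogSU : LoopAverage (SU N)) U c}).map (avOfPrint N S j).avg +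
        (νG j).map (avOfPrint N S j).avg := fun _ => rfl
  refine ⟨νG, h0, hsucc, ?_⟩
  intro k
  induction k with
  | zero => rw [h0]; simp
  | succ k ih =>
    have hmeas : Measurable (avOfPrint N S k).avg := (avgAC_avOfPrint N L S k).1
    rw [hsucc k, Measure.add_apply, Measure.map_apply hmeas MeasurableSet.univ, Measure.map_apply hmeas MeasurableSet.univ, Set.preimage_univ,
      Measure.restrict_apply_univ, ih, Finset.sum_range_succ, add_comm]

/-- ★ **AT PRINT'S AVERAGING THE ONE-STEP EXCESS OVER HAAR IS AT MOST THE IMAGE OF THE GUARDED PART: `dU_j∘Ū_j⁻¹ − dU_{j+1} ≤ (dU_j↾G_j)∘Ū_j⁻¹`** (`j + 1 ≤ K`):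
n08-w3's split `μ∘Ū⁻¹ ≤ μ∘axial⁻¹ + (μ↾G)∘Ū⁻¹` at `μ = dU_j` with `axial_*(dU_j) = dU_{j+1}` EXACTLY (`AveragingRT.map_axialAvg`).  So a density bound on the transported
GUARDED images bounds the transported one-step excesses, which bound `ν♯` (file 17 §4). [cite: Balaban1987RG1, (0.4) + (0.13) pp.253–254; Balaban1985UV3, (2) p.256 (bookkeeping)] -/
theorem oneStepExcess_avOfPrint_le_guard (j : ℕ) (hj : j + 1 ≤ S.K) :
    (fieldMeasure S.P j (SU N)).map (avOfPrint N S j).avg - fieldMeasure S.P (j + 1) (SU N) ≤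
      ((fieldMeasure S.P j (SU N)).restrict
          {U : GaugeField S.P j (SU N) | ∃ c : PBond S.P (j + 1), Small (expMeanLogSU : LoopAverage (SU N)) U c}).map (avOfPrint N S j).avg := by
  have hjr : j + 1 ≤ S.P.m + S.P.K := by show j + 1 ≤ S.m + S.K; omega
  refine Measure.sub_le_of_le_add ?_
  have h := map_avOfPrint_le N S hjr (fieldMeasure S.P j (SU N))
  rw [map_axialAvg (G := SU N) hjr] at h
  calc (fieldMeasure S.P j (SU N)).map (avOfPrint N S j).avg
      ≤ fieldMeasure S.P (j + 1) (SU N) + ((fieldMeasure S.P j (SU N)).restrict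
          {U : GaugeField S.P j (SU N) | ∃ c : PBond S.P (j + 1), Small (expMeanLogSU : LoopAverage (SU N)) U c}).map (avOfPrint N S j).avg := h
    _ = _ := add_comm _ _

/-- ★ **THE LEAST FAMILY IS BELOW THE GUARD FAMILY at print's averaging**: an excess-recursive `ν♯` (file 17 §4) satisfies `ν♯_k ≤ ν_k` (`k ≤ K`) for every guard-recursive
`ν` — so the located target (a) «`dν♯_k∕dV_k ≤ e^{c|T₁^{(k)}|} − 1` a.e.» is implied by the same bound on n08-w3's family, and is the weaker ask.
[cite: Balaban1987RG1, (0.4) p.253; Balaban1985Averaging, (15) p.19 (bookkeeping)] -/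
theorem excessRec_le_guardRec_avOfPrint (νs : ∀ k, Measure (GaugeField S.P k (SU N))) (h0 : νs 0 = 0)
    (hsucc : ∀ k, νs (k + 1) = (fieldMeasure S.P k (SU N) + νs k).map (avOfPrint N S k).avg - fieldMeasure S.P (k + 1) (SU N))
    (ν : ∀ k, Measure (GaugeField S.P k (SU N)))
    (hrec : ∀ j, j + 1 ≤ S.K →
      ((fieldMeasure S.P j (SU N)).restrict
          {U : GaugeField S.P j (SU N) | ∃ c : PBond S.P (j + 1), Small (expMeanLogSU : LoopAverage (SU N)) U c}).map (avOfPrint N S j).avg +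
        (ν j).map (avOfPrint N S j).avg ≤ ν (j + 1)) :
    ∀ k, k ≤ S.K → νs k ≤ ν k :=
  excessRec_le_of_weakClosed νs h0 hsucc (fun j => (avgAC_avOfPrint N L S j).1) S.K ν (weakClosed_avOfPrint_of_guardRec N S ν hrec)

/-- ★★ **THE UNCONDITIONAL BOUND IN ITS SHARPEST CLOSED-FAMILY FORM**: for print's averaging and the (unique) excess-recursive family `ν♯` of file 17 §4,
`m_k(h,·)·dU_k ≤ dU_k + ν♯_k` for every `k` (no range restriction: `ν♯` is weakly closed at every level by construction), every history, any thresholds.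
[cite: Balaban1985UV3, (41) p.266 + (48) p.268; Balaban1985Averaging, (15) p.19] -/
theorem withDensity_massRecAC_avOfPrint_le_excessRec (νs : ∀ k, Measure (GaugeField S.P k (SU N))) (h0 : νs 0 = 0)
    (hsucc : ∀ k, νs (k + 1) = (fieldMeasure S.P k (SU N) + νs k).map (avOfPrint N S k).avg - fieldMeasure S.P (k + 1) (SU N))
    (k : ℕ) (h : Hist S.P k) :
    (fieldMeasure S.P k (SU N)).withDensity (fun V => ENNReal.ofReal (massRecAC M₁ Rcol εL εS (avOfPrint N S) k h V)) ≤
      fieldMeasure S.P k (SU N) + νs k :=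
  withDensity_massRecAC_le_of_weakClosed M₁ Rcol εL εS (avOfPrint N S) (avgAC_avOfPrint N L S) k νs
    (fun j _ => weakClosed_of_excessRec νs h0 hsucc j) k le_rfl h

end Print

end Summit.QuantumFields.YangMills.BalabanUVNodes.N08MassesACLeastClosedFamilyPrint

end
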